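import Summits.HubbardSuperconductivity.HubbardSuperconductivity.Theorems.WeakCouplingBCSWcbcsKohnLuttingerB1gNotB1gLeaf

/-!
# The «Schatten pinch» ORDER certificate for the `t' = 0` Kohn–Luttinger rival margin (KL-MARGIN-SCAN HQ1 (ii))

Helper layer for the certificate half of `WcbcsKohnLuttingerB1g` (stmt-HubbardSuperconductivity-0158; reader seat
hubbard-klscan-idea-2, lens control, card «schatten-pinch-order-certificate»).  A Kohn–Luttinger `O(U²)` channel statement is not
ODLRO; nothing here proves superconductivity in the Hubbard model; nothing is asserted at `t' ≠ 0`, about `K₃`, the onset window or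
`U₀`.  This file contains NO numerical record: it fixes the SHAPE of an order certificate and proves that the shape decides the order.

THE CERTIFICATE.  `m(μ) := KlNotB1g.rivalMargin μ = min(λ_A2g, λ_B2g, λ_E)(μ) - λ_B1g(μ)` (`U = 1`, `λ_χ(μ) = channelInf ε₀ μ 1 χ`).
For two chemical potentials `μa` (smaller doping) and `μb` (larger doping), `PinchOrderCert μa μb` asks for reals `R, S, ω` with
  (F) a Rayleigh FLOOR      `R ≤ -λ_B1g(μa)`          (one explicit trial pair function);
  (C) a Schatten CEILING    `-λ_B1g(μb) ≤ S`          (intended `S = ‖K̂ᴮ_{μb}‖_{S_p}`, `p = 2` or `4`: gap-free, `|λ| ≤ ‖K‖_op ≤ (tr|K|^p)^{1/p}`);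
  (D) a rival DRIFT bound   `λ_χ(μb) - ω ≤ λ_χ(μa)` for every rival `χ` (intended `ω = ‖(K̂^χ_{μa} - K̂^χ_{μb}) - P‖_HS`, `P ⪰ 0` explicit);
  (G) the check             `S + ω < R`;
and then `m(μb) < m(μa)` (`rivalMargin_lt_of_pinch`).  Six consecutive certificates on the doping grid `{0.05, …, 0.35}` make the
margin strictly antitone along the grid (`rivalMargin_strictAnti_grid`).  §3 proves the finite-dimensional MODEL inequalities behind
(C) and (D): `λ² ≤ ‖A‖_F²`, `λ⁴ ≤ ‖A²‖_F²` for an eigen-relation of a real square array, and `-⟨u, D u⟩ ≤ ‖D - P‖_F` for `P ⪰ 0`,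
`‖u‖ = 1` (the matrix core; the `KLBlock` enclosure layer is what carries them to `channelInf`).
References: [ReedSimonI1980] Thm VI.22, [Simon2005TraceIdeals] §1–2 (`‖A‖ ≤ ‖A‖_p`), [HornJohnson2013] §4.3 (Weyl monotonicity),
[RaghuKivelsonScalapino2010] §III (the float picture at `t' = 0`).  Float evidence (not used here): evidence #54 on stmt-0158.
-/

noncomputable section

-- the tree's namespace convention repeats the summit name by design (D-0017)
set_option linter.dupNamespace false

open Real Set Finset
open Literature.MathematicalPhysics.QuantumLattice
open Summit.HubbardSuperconductivity.HubbardSuperconductivity.Theorems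
open Summit.HubbardSuperconductivity.HubbardSuperconductivity.Theorems.KlNotB1g

namespace Summit.HubbardSuperconductivity.HubbardSuperconductivity.Theorems.KlPinchOrder

/-! ## §1  The pinch order lemma (tree currency: `KlNotB1g.rivalMargin`, `KlNotB1g.IsRival`, `channelInf`) -/

/-- **Pinch order certificate** for the pair `(μa, μb)` (`μa` = the smaller doping, `μb` = the larger): a floor `R` on the
`B1g` coupling at `μa`, a ceiling `S` on it at `μb`, a uniform rival drift bound `ω`, and the strict check `S + ω < R`. -/
def PinchOrderCert (μa μb : ℝ) : Prop :=
  ∃ R S ω : ℝ,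
    R ≤ -channelInf (squareDispersion 1 0) μa 1 D4Irrep.B1g ∧
    -channelInf (squareDispersion 1 0) μb 1 D4Irrep.B1g ≤ S ∧
    (∀ χ : D4Irrep, IsRival χ →
      channelInf (squareDispersion 1 0) μb 1 χ - ω ≤ channelInf (squareDispersion 1 0) μa 1 χ) ∧
    S + ω < R

/-- **The order lemma (PROVED).**  A pinch order certificate for `(μa, μb)` gives `m(μb) < m(μa)` for the tree's rival margin. -/
theorem rivalMargin_lt_of_pinch {μa μb : ℝ} (h : PinchOrderCert μa μb) : rivalMargin μb < rivalMargin μa := by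
  obtain ⟨R, S, ω, hR, hS, hd, hc⟩ := h
  have hA := hd D4Irrep.A2g ⟨by decide, by decide⟩
  have hB := hd D4Irrep.B2g ⟨by decide, by decide⟩
  have hE := hd D4Irrep.E ⟨by decide, by decide⟩
  unfold rivalMargin
  set a2 := channelInf (squareDispersion 1 0) μa 1 D4Irrep.A2g
  set b2 := channelInf (squareDispersion 1 0) μa 1 D4Irrep.B2g
  set e2 := channelInf (squareDispersion 1 0) μa 1 D4Irrep.E
  set a1 := channelInf (squareDispersion 1 0) μb 1 D4Irrep.A2g
  set b1 := channelInf (squareDispersion 1 0) μb 1 D4Irrep.B2g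
  set e1 := channelInf (squareDispersion 1 0) μb 1 D4Irrep.E
  have hmin : min (min a1 b1) e1 - ω ≤ min (min a2 b2) e2 := by
    refine le_min (le_min ?_ ?_) ?_
    · linarith [min_le_left (min a1 b1) e1, min_le_left a1 b1]
    · linarith [min_le_left (min a1 b1) e1, min_le_right a1 b1]
    · linarith [min_le_right (min a1 b1) e1]
  linarith

/-- `μ(δ)` in the consumer's currency (as in `muOfDoping_mem_window_d010_d020`). -/
def muOfDoping (δ : ℝ) : ℝ := chemicalPotentialOfDensity (squareDispersion 1 0) (1 - δ)

/-- The scan grid `δ ∈ {0.05, 0.10, …, 0.35}` of SCAN-TABLE v0.2 (`t' = 0` column). -/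
def gridδ : Fin 7 → ℝ := ![0.05, 0.10, 0.15, 0.20, 0.25, 0.30, 0.35]

/-- **HQ1 (ii) at `t' = 0`, grid form, tree currency**: the rival margin strictly DEcreases along the doping grid,
`m(μ(δ_{i+1})) < m(μ(δ_i))` for the six adjacent pairs (float: `0.460 > 0.286 > 0.207 > 0.150 > 0.107 > 0.072 > 0.038`). -/
def GridOrderT0 : Prop := ∀ i : Fin 6, rivalMargin (muOfDoping (gridδ i.succ)) < rivalMargin (muOfDoping (gridδ i.castSucc))

/-- **Six certificates give HQ1 (ii) on the grid (PROVED).** -/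
theorem gridOrderT0_of_pinch (h : ∀ i : Fin 6, PinchOrderCert (muOfDoping (gridδ i.castSucc)) (muOfDoping (gridδ i.succ))) :
    GridOrderT0 := fun i => rivalMargin_lt_of_pinch (h i)

/-- Chaining (PROVED): the six consecutive certificates make `i ↦ m(μ(δ_i))` strictly antitone on the whole grid. -/
theorem rivalMargin_strictAnti_grid (h : ∀ i : Fin 6, PinchOrderCert (muOfDoping (gridδ i.castSucc)) (muOfDoping (gridδ i.succ))) :
    StrictAnti (fun i : Fin 7 => rivalMargin (muOfDoping (gridδ i))) :=
  Fin.strictAnti_iff_succ_lt.2 fun i => rivalMargin_lt_of_pinch (h i)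

/-! ## §2  The three analytic inputs, typed over `channelInf` (the leaves a certificate record would land)

(F) is the tree's existing Ritz/Rayleigh device (`klCertB1gWin*` records give such floors on whole `μ`-windows; here one point).
(C) is the NEW direction: a gap-free CEILING on the `d`-wave coupling from a Schatten norm of the folded `B1g` kernel.  (D) is the
rival drift with an explicit psd deflation.  Informal definitions of the numbers `S`, `ω` (the record's job, via the tree's
`pairingForm_eq_polar` / radial transport to the common circle and `KLBlock`-style box enclosures):
  `S(μ)   = ( ∫⁴ k̂ᴮ_μ(θ₁,θ₂) k̂ᴮ_μ(θ₂,θ₃) k̂ᴮ_μ(θ₃,θ₄) k̂ᴮ_μ(θ₄,θ₁) dθ )^{1/4}`  (or the HS double integral, `p = 2`),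
  `ω_χ    = ( ∫∫ ( k̂^χ_{μa} - k̂^χ_{μb} - p_χ )² dθ dθ' )^{1/2}`,  `p_χ = Σ_k θ_k v_k ⊗ v_k`, `θ_k ≥ 0`, `v_k` explicit,
where `k̂^χ_μ(θ,θ') = √w_μ(θ) K^χ_μ(θ,θ') √w_μ(θ')` is the `χ`-twisted Kohn–Luttinger kernel folded to the fundamental arc. -/

/-- (F) Rayleigh floor at `μ`. -/
def RayleighFloor (μ R : ℝ) : Prop := R ≤ -channelInf (squareDispersion 1 0) μ 1 D4Irrep.B1g

/-- (C) Schatten ceiling at `μ` — the new leaf.  Content: `-channelInf ε₀ μ 1 B1g ≤ ‖K̂ᴮ_μ‖_{S_p}`; as a record it is the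
inequality with the engine's enclosed upper value `S` of that norm. -/
def SchattenCeiling (μ S : ℝ) : Prop := -channelInf (squareDispersion 1 0) μ 1 D4Irrep.B1g ≤ S

/-- (D) Rival drift bound for the pair. -/
def RivalDrift (μa μb ω : ℝ) : Prop :=
  ∀ χ : D4Irrep, IsRival χ → channelInf (squareDispersion 1 0) μb 1 χ - ω ≤ channelInf (squareDispersion 1 0) μa 1 χ

/-- Assembly of the leaves (PROVED, definitional). -/
theorem pinch_of_leaves {μa μb R S ω : ℝ} (hF : RayleighFloor μa R) (hC : SchattenCeiling μb S) (hD : RivalDrift μa μb ω)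
    (hG : S + ω < R) : PinchOrderCert μa μb := ⟨R, S, ω, hF, hC, hD, hG⟩

/-! ## §3  The finite-dimensional model inequalities (PROVED) — the matrix core of (C) and (D)

Stated for a real `n × n` array `A` and an eigen-relation written out in coordinates (no `Matrix` API needed). -/

/-- **(C), model, `p = 2`:** an eigenvalue of a real square array is bounded by the Frobenius (Hilbert–Schmidt) norm:
`A v = λ v`, `v ≠ 0` ⇒ `λ² ≤ Σᵢⱼ Aᵢⱼ²`.  Row-wise Cauchy–Schwarz. [folklore; Reed–Simon I, Thm. VI.22 (e)] -/
theorem eig_sq_le_frobSq {n : ℕ} (A : Fin n → Fin n → ℝ) (v : Fin n → ℝ) (lam : ℝ)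
    (h : ∀ i, ∑ j, A i j * v j = lam * v i) (hv : 0 < ∑ i, v i ^ 2) : lam ^ 2 ≤ ∑ i, ∑ j, A i j ^ 2 := by
  have key : ∀ i, (lam * v i) ^ 2 ≤ (∑ j, A i j ^ 2) * ∑ j, v j ^ 2 := fun i => by
    rw [← h i]; exact Finset.sum_mul_sq_le_sq_mul_sq _ _ _
  have hsum : lam ^ 2 * ∑ i, v i ^ 2 ≤ (∑ i, ∑ j, A i j ^ 2) * ∑ i, v i ^ 2 := by
    calc lam ^ 2 * ∑ i, v i ^ 2 = ∑ i, (lam * v i) ^ 2 := by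
            rw [Finset.mul_sum]; exact Finset.sum_congr rfl fun i _ => by ring
      _ ≤ ∑ i, (∑ j, A i j ^ 2) * ∑ j, v j ^ 2 := Finset.sum_le_sum fun i _ => key i
      _ = (∑ i, ∑ j, A i j ^ 2) * ∑ i, v i ^ 2 := by rw [Finset.sum_mul]
  exact le_of_mul_le_mul_right hsum hv

/-- **(C), model, `p = 4`:** `A v = λ v`, `v ≠ 0` ⇒ `λ⁴ ≤ Σᵢⱼ (A²)ᵢⱼ² = tr A⁴` (for symmetric `A`; here for any real array
with `A² := Σₘ Aᵢₘ Aₘⱼ`).  From `eig_sq_le_frobSq` applied to `A²`, whose eigen-relation `A² v = λ² v` follows from `A v = λ v`. -/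
theorem eig_pow_four_le_frobSq_sq {n : ℕ} (A : Fin n → Fin n → ℝ) (v : Fin n → ℝ) (lam : ℝ)
    (h : ∀ i, ∑ j, A i j * v j = lam * v i) (hv : 0 < ∑ i, v i ^ 2) :
    lam ^ 4 ≤ ∑ i, ∑ j, (∑ m, A i m * A m j) ^ 2 := by
  have h2 : ∀ i, ∑ j, (∑ m, A i m * A m j) * v j = lam ^ 2 * v i := by
    intro i
    calc ∑ j, (∑ m, A i m * A m j) * v j = ∑ j, ∑ m, A i m * A m j * v j := by simp only [Finset.sum_mul]
      _ = ∑ m, ∑ j, A i m * A m j * v j := Finset.sum_comm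
      _ = ∑ m, A i m * ∑ j, A m j * v j := Finset.sum_congr rfl fun m _ => by
            rw [Finset.mul_sum]; exact Finset.sum_congr rfl fun j _ => by ring
      _ = ∑ m, A i m * (lam * v m) := Finset.sum_congr rfl fun m _ => by rw [h m]
      _ = lam * ∑ m, A i m * v m := by rw [Finset.mul_sum]; exact Finset.sum_congr rfl fun m _ => by ring
      _ = lam ^ 2 * v i := by rw [h i]; ring
  have := eig_sq_le_frobSq (fun i j => ∑ m, A i m * A m j) v (lam ^ 2) h2 hv
  calc lam ^ 4 = (lam ^ 2) ^ 2 := by ring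
    _ ≤ _ := this

/-- **(D), model:** for real square arrays `D`, `P` with `P` positive semidefinite (as a quadratic form) and a unit vector `u`,
`-⟨u, D u⟩ ≤ ‖D - P‖_F`.  (Loewner monotonicity `-D ⪯ -(D - P)`, then `|⟨u, M u⟩| ≤ ‖M u‖ ≤ ‖M‖_F` by Cauchy–Schwarz twice.)
With `D = K̂^χ_{μa} - K̂^χ_{μb}` this is the rival drift bound (D): `λ_min(K̂^χ_{μa}) ≥ λ_min(K̂^χ_{μb}) - ‖D - P‖_F`. [folklore] -/
theorem negQuad_le_frob_of_psd {n : ℕ} (D P : Fin n → Fin n → ℝ) (u : Fin n → ℝ)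
    (hP : 0 ≤ ∑ i, ∑ j, u i * P i j * u j) (hu : ∑ i, u i ^ 2 = 1) :
    -(∑ i, ∑ j, u i * D i j * u j) ≤ Real.sqrt (∑ i, ∑ j, (D i j - P i j) ^ 2) := by
  set M : Fin n → Fin n → ℝ := fun i j => D i j - P i j with hM
  -- `-⟨u,Du⟩ = -⟨u,Mu⟩ - ⟨u,Pu⟩ ≤ -⟨u,Mu⟩`
  have hsplit : -(∑ i, ∑ j, u i * D i j * u j) = -(∑ i, ∑ j, u i * M i j * u j) - ∑ i, ∑ j, u i * P i j * u j := by
    simp only [hM, mul_sub, sub_mul, Finset.sum_sub_distrib]; ring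
  have hle : -(∑ i, ∑ j, u i * D i j * u j) ≤ |∑ i, ∑ j, u i * M i j * u j| := by
    rw [hsplit]
    have := neg_abs_le (∑ i, ∑ j, u i * M i j * u j)
    linarith
  refine hle.trans (Real.abs_le_sqrt ?_)
  -- `⟨u, M u⟩² ≤ (Σᵢ uᵢ²) (Σᵢ (M u)ᵢ²) = Σᵢ (Σⱼ Mᵢⱼ uⱼ)² ≤ Σᵢ (Σⱼ Mᵢⱼ²)(Σⱼ uⱼ²) = ‖M‖_F²`
  have hrew : ∑ i, ∑ j, u i * M i j * u j = ∑ i, u i * ∑ j, M i j * u j := by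
    refine Finset.sum_congr rfl fun i _ => ?_
    rw [Finset.mul_sum]; exact Finset.sum_congr rfl fun j _ => by ring
  have h1 : (∑ i, u i * ∑ j, M i j * u j) ^ 2 ≤ (∑ i, u i ^ 2) * ∑ i, (∑ j, M i j * u j) ^ 2 :=
    Finset.sum_mul_sq_le_sq_mul_sq _ _ _
  have h2 : ∀ i, (∑ j, M i j * u j) ^ 2 ≤ (∑ j, M i j ^ 2) * ∑ j, u j ^ 2 := fun i => Finset.sum_mul_sq_le_sq_mul_sq _ _ _
  calc (∑ i, ∑ j, u i * M i j * u j) ^ 2 = (∑ i, u i * ∑ j, M i j * u j) ^ 2 := by rw [hrew]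
    _ ≤ (∑ i, u i ^ 2) * ∑ i, (∑ j, M i j * u j) ^ 2 := h1
    _ = ∑ i, (∑ j, M i j * u j) ^ 2 := by rw [hu, one_mul]
    _ ≤ ∑ i, (∑ j, M i j ^ 2) * ∑ j, u j ^ 2 := Finset.sum_le_sum fun i _ => h2 i
    _ = ∑ i, ∑ j, M i j ^ 2 := by simp [hu]
    _ = ∑ i, ∑ j, (D i j - P i j) ^ 2 := by simp [hM]

/-- **(D), model, eigen-form (PROVED from the previous):** if `u` is a unit eigenvector of `D` with eigenvalue `κ`
(`D u = κ u`), then `-κ ≤ ‖D - P‖_F` for every psd `P`; i.e. `λ_min(D) ≥ -‖D - P‖_F`. -/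
theorem negEig_le_frob_of_psd {n : ℕ} (D P : Fin n → Fin n → ℝ) (u : Fin n → ℝ) (κ : ℝ)
    (hD : ∀ i, ∑ j, D i j * u j = κ * u i) (hP : 0 ≤ ∑ i, ∑ j, u i * P i j * u j) (hu : ∑ i, u i ^ 2 = 1) :
    -κ ≤ Real.sqrt (∑ i, ∑ j, (D i j - P i j) ^ 2) := by
  have hq : ∑ i, ∑ j, u i * D i j * u j = κ := by
    calc ∑ i, ∑ j, u i * D i j * u j = ∑ i, u i * ∑ j, D i j * u j := by
            refine Finset.sum_congr rfl fun i _ => ?_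
            rw [Finset.mul_sum]; exact Finset.sum_congr rfl fun j _ => by ring
      _ = ∑ i, u i * (κ * u i) := Finset.sum_congr rfl fun i _ => by rw [hD i]
      _ = κ * ∑ i, u i ^ 2 := by rw [Finset.mul_sum]; exact Finset.sum_congr rfl fun i _ => by ring
      _ = κ := by rw [hu, mul_one]
  have := negQuad_le_frob_of_psd D P u hP hu
  rwa [hq] at this

end Summit.HubbardSuperconductivity.HubbardSuperconductivity.Theorems.KlPinchOrder
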